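import Literature.Computability.AlgebraicComplexity.LRCanonicalWeights
import Literature.Computability.AlgebraicComplexity.LR21TorusWeights
import HarnessLib

/-!
# Landsberg–Ressayre, Thm. 2.1 — the weights of the two-sided canonical subspaces (LR17 §6)

Topic `Literature/Computability/AlgebraicComplexity`.  Continues `LR21TorusWeights.lean`
(two-sided torus datum `D`, weights `wt w`, comparison spaces `Z S' w`) in the bottom-up proof of
`lr_full_equivariant_lower` (LR17 Thm. 2.1, lower bound); two-sided companion of
`LRCanonicalWeights.lean`:

* `comap_le_iSup`, `comap_le_iSup_sup_ker`: the weights of `Λ⁻¹ P` for a `B`-stable `P`;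
* **weights of `𝒫_S`** (`S ⊆ [m] ⊔ [m]`): `canon₂_le_grid` — `𝒫_S ⊆ ⨁_{0 ≠ w, supp₂ w ⊆ S} E (wt w)`
  (LR17 §6: the weights of the chain are sums of the steps `ε_k + ε'_j`);
  `canon₂_inf_wt_le_canon₂_supp` — the weight-`wt w` part of `𝒫_S` already lies in `𝒫_{supp₂ w}`;
  `canon₂_le_iSup_inf` — `𝒫_S` is the sum of these parts;
* **descent** (`exists_pred_of_canon₂_inf_wt_ne_bot`): a weight `wt w` of `𝒫_S` with `w` not a
  step vector `st k j` comes from a weight `wt (w - st k j)` of `𝒫_S ∩ range Λ` with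
  `inl k, inr j ∈ S` (LR's `ℓ(χ_{ℍ_{i+1}}) ≤ ℓ(χ_{ℍ_i}) + 1`, read downwards, two-sidedly).

## References

* J. M. Landsberg, N. Ressayre, *Permanent v. determinant: an exponential lower bound assuming
  symmetry and a potential path towards Valiant's conjecture*, Differential Geom. Appl. 55 (2017)
  146–166, arXiv:1508.05788, §6 (proofs of Thm. 2.8 and Thm. 2.1).
-/

noncomputable section

namespace Literature.Computability.AlgebraicComplexity

namespace LRPencil

namespace TorusData₂

open Submodule Module.End Finset

variable {V : Type*} [AddCommGroup V] [Module ℂ V] [FiniteDimensional ℂ V] {m : ℕ}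
  (D : TorusData₂ m V)

/-! ### Weights of `Λ⁻¹ P` -/

/-- For a `B`-stable `P`: `Λ⁻¹ P ⊆ Σ_γ (Λ⁻¹ (P ∩ E γ) ∩ F γ)`. [cite: LandsbergRessayre2017, §6] -/
theorem comap_le_iSup {P : Submodule ℂ V} (hP : P.map D.B ≤ P) :
    P.comap D.Λ ≤ ⨆ γ, (P ⊓ D.E γ).comap D.Λ ⊓ D.F γ := by
  have hW : (P.comap D.Λ).map D.C ≤ P.comap D.Λ := by
    rw [← D.L.comap_map_eq]; exact Submodule.comap_mono hP
  calc P.comap D.Λ = ⨆ γ, P.comap D.Λ ⊓ D.F γ := eq_iSup_inf_maxGen _ hW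
    _ ≤ ⨆ γ, (P ⊓ D.E γ).comap D.Λ ⊓ D.F γ := iSup_mono fun γ => ?_
  rintro w ⟨hw, hwγ⟩
  refine ⟨?_, hwγ⟩
  simp only [SetLike.mem_coe, Submodule.mem_comap, Submodule.mem_inf] at hw ⊢
  exact ⟨hw, D.map_Λ_F_le γ (Submodule.mem_map_of_mem hwγ)⟩

/-- The same when the weights of `P` lie in a given family `w`: `Λ⁻¹ P` is contained in
`Σ_i (Λ⁻¹ (P ∩ E (w i)) ∩ F (w i)) + ker Λ`. [cite: LandsbergRessayre2017, §6] -/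
theorem comap_le_iSup_sup_ker {ι : Type*} (w : ι → ℂ) {P : Submodule ℂ V}
    (hP : P.map D.B ≤ P) (hPw : P ≤ ⨆ i, D.E (w i)) :
    P.comap D.Λ ≤ (⨆ i, (P ⊓ D.E (w i)).comap D.Λ ⊓ D.F (w i)) ⊔ LinearMap.ker D.Λ := by
  refine (D.comap_le_iSup hP).trans (iSup_le fun γ => ?_)
  by_cases h : ∃ i, w i = γ
  · obtain ⟨i, rfl⟩ := h
    exact (le_iSup (fun i => (P ⊓ D.E (w i)).comap D.Λ ⊓ D.F (w i)) i).trans le_sup_left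
  · push Not at h
    have h0 : P ⊓ D.E γ = ⊥ := by
      rw [eq_bot_iff]
      calc P ⊓ D.E γ ≤ (⨆ i, D.E (w i)) ⊓ D.E γ := inf_le_inf_right _ hPw
        _ = ⊥ := iSup_maxGen_inf_eq_bot _ w h
    rw [h0, Submodule.comap_bot]
    exact inf_le_left.trans le_sup_right

/-! ### Weights of the canonical subspaces -/

/-- The comparison space `Σ_{w ∈ U₂ S} Z S' w` is closed under `S`, hence contains `𝒫_S`. [folklore] -/
theorem canon₂_le_iSup_Z (S S' : Finset (Fin m ⊕ Fin m)) :
    canon₂ D.Λ D.A S ≤ ⨆ w : U₂ S, D.Z S' w := by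
  set G : Submodule ℂ V := ⨆ w : U₂ S, D.Z S' w with hG
  have hGst : G.map D.B ≤ G := by
    rw [hG, Submodule.map_iSup]
    exact iSup_mono fun w => D.map_Z_le S' w
  have hGw : G ≤ ⨆ w : U₂ S, D.E (D.wt w) := iSup_mono fun w => D.Z_le_E S' w
  have hpiece : ∀ w : U₂ S, G ⊓ D.E (D.wt w) ≤ D.Z S' w := fun w => by
    refine (iSup_inf_maxGen_le _ (fun w : U₂ S => D.Z S' w) (fun w => D.wt w)
      (fun w => D.Z_le_E S' w) (D.wt w)).trans (iSup₂_le fun w' hw' => ?_)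
    rw [Subtype.ext (D.wt_injective hw')]
  apply canon₂_le
  intro k j hk hj
  refine (Submodule.map_mono (D.comap_le_iSup_sup_ker (fun w : U₂ S => D.wt w) hGst hGw)).trans ?_
  rw [Submodule.map_sup, Submodule.map_iSup]
  refine sup_le (iSup_le fun w => ?_) ?_
  · calc (((G ⊓ D.E (D.wt w)).comap D.Λ ⊓ D.F (D.wt w)).map (D.A k j))
        ≤ (((D.Z S' w).comap D.Λ ⊓ D.F (D.wt w)).map (D.A k j)) :=
          Submodule.map_mono (inf_le_inf_right _ (Submodule.comap_mono (hpiece w)))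
      _ ≤ D.Z S' ((w : Fin m ⊕ Fin m → ℕ) + st k j) := D.map_comap_Z_le S' k j w
      _ ≤ G := le_iSup (fun w : U₂ S => D.Z S' w) ⟨(w : Fin m ⊕ Fin m → ℕ) + st k j,
          add_st_mem_U₂ w.2.2 hk hj⟩
  · calc (LinearMap.ker D.Λ).map (D.A k j) ≤ D.Z S' (0 + st k j) := D.map_ker_le_Z S' k j
      _ ≤ G := le_iSup (fun w : U₂ S => D.Z S' w) ⟨_, st_mem_U₂ hk hj⟩

/-- **Weights of `𝒫_S` refine along supports**: for `w ≠ 0` with `supp₂ w ⊆ S'`, the weight-`wt w`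
part of `𝒫_S` lies in `𝒫_{S'}` (LR17 §6: a weight is reached only through the rows and columns
in its support). [cite: LandsbergRessayre2017, §6] -/
theorem canon₂_inf_wt_le {S S' : Finset (Fin m ⊕ Fin m)} {w : Fin m ⊕ Fin m → ℕ} (hU : w ∈ U₂ S)
    (hw : supp₂ w ⊆ S') :
    canon₂ D.Λ D.A S ⊓ D.E (D.wt w) ≤ canon₂ D.Λ D.A S' ⊓ D.E (D.wt w) :=
  calc canon₂ D.Λ D.A S ⊓ D.E (D.wt w) ≤ (⨆ w : U₂ S, D.Z S' w) ⊓ D.E (D.wt w) :=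
        inf_le_inf_right _ (D.canon₂_le_iSup_Z S S')
    _ ≤ ⨆ (w' : U₂ S) (_ : D.wt w' = D.wt w), D.Z S' w' :=
        iSup_inf_maxGen_le _ _ (fun w' : U₂ S => D.wt w') (fun w' => D.Z_le_E S' w') _
    _ ≤ D.Z S' w := iSup₂_le fun w' hw' => by
        rw [show w' = ⟨w, hU⟩ from Subtype.ext (D.wt_injective hw')]
    _ = canon₂ D.Λ D.A S' ⊓ D.E (D.wt w) := if_pos hw

/-- In particular the weight-`wt w` part of `𝒫_S` lies in `𝒫_{supp₂ w}`. [cite: LandsbergRessayre2017, §6] -/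
theorem canon₂_inf_wt_le_canon₂_supp {S : Finset (Fin m ⊕ Fin m)} {w : Fin m ⊕ Fin m → ℕ}
    (hw : w ∈ U₂ S) : canon₂ D.Λ D.A S ⊓ D.E (D.wt w) ≤ canon₂ D.Λ D.A (supp₂ w) :=
  (D.canon₂_inf_wt_le hw subset_rfl).trans inf_le_left

/-- **The weights of `𝒫_S`** are among the `wt w`, `0 ≠ w`, `supp₂ w ⊆ S`:
`𝒫_S ⊆ ⨁_{w ∈ U₂ S} E (wt w)`. [cite: LandsbergRessayre2017, §6] -/
theorem canon₂_le_grid (S : Finset (Fin m ⊕ Fin m)) :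
    canon₂ D.Λ D.A S ≤ ⨆ w : U₂ S, D.E (D.wt w) :=
  (D.canon₂_le_iSup_Z S ∅).trans (iSup_mono fun w => D.Z_le_E ∅ w)

/-- Hence `𝒫_S` is the sum of its pieces of weight `wt w`, `w ∈ U₂ S`. [cite: LandsbergRessayre2017, §6] -/
theorem canon₂_le_iSup_inf (S : Finset (Fin m ⊕ Fin m)) :
    canon₂ D.Λ D.A S ≤ ⨆ w : U₂ S, canon₂ D.Λ D.A S ⊓ D.E (D.wt w) := by
  have hst : (canon₂ D.Λ D.A S).map D.B ≤ canon₂ D.Λ D.A S := (D.L.map_canon₂_eq_self S).le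
  conv_lhs => rw [eq_iSup_inf_maxGen _ hst]
  refine iSup_le fun β => ?_
  by_cases h : ∃ w : U₂ S, D.wt w = β
  · obtain ⟨w, rfl⟩ := h
    exact le_iSup (fun w : U₂ S => canon₂ D.Λ D.A S ⊓ D.E (D.wt w)) w
  · push Not at h
    have : canon₂ D.Λ D.A S ⊓ D.E β = ⊥ := by
      rw [eq_bot_iff]
      calc canon₂ D.Λ D.A S ⊓ D.E β ≤ (⨆ w : U₂ S, D.E (D.wt w)) ⊓ D.E β :=
            inf_le_inf_right _ (D.canon₂_le_grid S)
        _ = ⊥ := iSup_maxGen_inf_eq_bot _ _ h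
    rw [this]; exact bot_le

/-! ### Descent -/

/-- **Descent** (LR17 §6, `ℓ(χ_{ℍ_{i+1}}) ≤ ℓ(χ_{ℍ_i}) + 1`, read downwards): if `𝒫_S` has weight
`wt w` with `w ≠ st k j` for all `k, j`, then `w = w' + st k j` with `inl k, inr j ∈ S`,
`w' ∈ U₂ S`, and `wt w'` is a weight of `𝒫_S ∩ range Λ`. [cite: LandsbergRessayre2017, §6] -/
theorem exists_pred_of_canon₂_inf_wt_ne_bot {S : Finset (Fin m ⊕ Fin m)} {w : Fin m ⊕ Fin m → ℕ}
    (hu1 : ∀ k j, w ≠ 0 + st k j) (hne : canon₂ D.Λ D.A S ⊓ D.E (D.wt w) ≠ ⊥) :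
    ∃ k j, Sum.inl k ∈ S ∧ Sum.inr j ∈ S ∧ ∃ w' ∈ U₂ S, w = w' + st k j ∧
      canon₂ D.Λ D.A S ⊓ D.E (D.wt w') ⊓ LinearMap.range D.Λ ≠ ⊥ := by
  classical
  set P := canon₂ D.Λ D.A S with hP
  have hst : P.map D.B ≤ P := (D.L.map_canon₂_eq_self S).le
  -- the candidate pieces, indexed by `(k, j, w')` (`w' = none` encodes `ker Λ`)
  let Y : Fin m × Fin m × Option (U₂ S) → Submodule ℂ V := fun i =>
    if Sum.inl i.1 ∈ S ∧ Sum.inr i.2.1 ∈ S then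
      (match i.2.2 with
        | some w' => ((P ⊓ D.E (D.wt w')).comap D.Λ ⊓ D.F (D.wt w')).map (D.A i.1 i.2.1)
        | none => (LinearMap.ker D.Λ).map (D.A i.1 i.2.1))
    else ⊥
  let wY : Fin m × Fin m × Option (U₂ S) → ℂ := fun i =>
    match i.2.2 with
    | some w' => D.wt (w'.1 + st i.1 i.2.1)
    | none => D.wt (0 + st i.1 i.2.1)
  have hY : ∀ i, Y i ≤ D.E (wY i) := by
    rintro ⟨k, j, _ | w'⟩
    · by_cases hk : Sum.inl k ∈ S ∧ Sum.inr j ∈ S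
      · simp only [Y, wY, if_pos hk]; exact D.map_A_ker_le k j
      · simp only [Y, if_neg hk]; exact bot_le
    · by_cases hk : Sum.inl k ∈ S ∧ Sum.inr j ∈ S
      · simp only [Y, wY, if_pos hk]
        exact (Submodule.map_mono inf_le_right).trans (D.map_A_F_wt_le k j w')
      · simp only [Y, if_neg hk]; exact bot_le
  have hPY : P ≤ ⨆ i, Y i := by
    refine (canon₂_le_step S).trans (iSup₂_le fun k hk => iSup₂_le fun j hj => ?_)
    have hkj : Sum.inl k ∈ S ∧ Sum.inr j ∈ S := ⟨hk, hj⟩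
    refine (Submodule.map_mono (D.comap_le_iSup_sup_ker (fun w : U₂ S => D.wt w) hst
      (D.canon₂_le_grid S))).trans ?_
    rw [Submodule.map_sup, Submodule.map_iSup]
    refine sup_le (iSup_le fun w' => ?_) ?_
    · refine le_trans (le_of_eq ?_) (le_iSup Y (k, j, some w'))
      simp only [Y, if_pos hkj]
    · refine le_trans (le_of_eq ?_) (le_iSup Y (k, j, none))
      simp only [Y, if_pos hkj]
  have hex : P ⊓ D.E (D.wt w) ≤ ⨆ (i) (_ : wY i = D.wt w), Y i :=
    (inf_le_inf_right _ hPY).trans (iSup_inf_maxGen_le _ Y wY hY _)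
  -- some candidate piece of weight `wt w` is non-zero
  obtain ⟨i, hwi, hYi⟩ : ∃ i, wY i = D.wt w ∧ Y i ≠ ⊥ := by
    by_contra hall
    push Not at hall
    apply hne
    rw [eq_bot_iff]
    exact hex.trans (iSup₂_le fun i hi => (hall i hi).le)
  rcases i with ⟨k, j, _ | w'⟩
  · exact (hu1 k j (D.wt_injective hwi).symm).elim
  · have hk : Sum.inl k ∈ S ∧ Sum.inr j ∈ S := by
      by_contra hk
      exact hYi (by simp only [Y, if_neg hk])
    have hYi' : ((P ⊓ D.E (D.wt w')).comap D.Λ ⊓ D.F (D.wt w')).map (D.A k j) ≠ ⊥ := by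
      intro h; apply hYi; simp only [Y, if_pos hk]; exact h
    refine ⟨k, j, hk.1, hk.2, w', w'.2, (D.wt_injective hwi).symm, ?_⟩
    -- a non-zero vector of `Λ⁻¹(P ∩ E (wt w')) ∩ F (wt w')` is not in `ker Λ`
    intro hbot
    apply hYi'
    rw [eq_bot_iff]
    rintro _ ⟨x, ⟨hx1, hx2⟩, rfl⟩
    rw [Submodule.mem_bot]
    have hΛx : D.Λ x ∈ P ⊓ D.E (D.wt w') ⊓ LinearMap.range D.Λ :=
      ⟨hx1, LinearMap.mem_range_self _ _⟩
    rw [hbot, Submodule.mem_bot] at hΛx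
    have hxK : x ∈ LinearMap.ker D.Λ ⊓ D.F (D.wt w') := ⟨hΛx, hx2⟩
    rw [D.ker_inf_F_wt_eq_bot w'.2.1, Submodule.mem_bot] at hxK
    rw [hxK, map_zero]

end TorusData₂

end LRPencil

end Literature.Computability.AlgebraicComplexity
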